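import Mathlib
import Literature.Barriers.CriticalPhenomena.PlanarEdwardsModelDiffusiveSRWLocalCLT

/-!
# Herglotz's theorem for positive-definite real sequences, via Fejér means — the trigonometric sums

Support for `stub_stieltjesOfPencil` (line `cayley-pencil`, crux `StieltjesRepresentation` of route
`ContactStieltjesMeasure`), part 2/5.

For `c : ℕ → ℝ` with the Toeplitz forms `Σ_{m,n<M} a_m a_n c_{|m-n|}` nonnegative (Toeplitz positivity, carried as the
explicit hypothesis `hc`):
`|c k| ≤ c 0`; the Fejér means `F_M(θ) = Σ_{m,n<M} c_{|m-n|} cos((m-n)θ) = M c_0 + 2Σ_{1≤k<M}(M-k) c_k cos kθ`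
are nonnegative (two Toeplitz forms with `a_m = cos mθ`, `b_m = sin mθ`); orthogonality of `cos(kθ)` on
`[-π, π]`; the moments `∫_{-π}^{π} cos(kθ) F_M(θ) dθ = 2π (M - k)₊ c_k`.
-/

noncomputable section

open scoped BigOperators Real Topology ENNReal
open Finset MeasureTheory Filter

namespace Summit.AtomisticToContinuum.FouriersLaw.Theorems.ContactStieltjesMeasure.CayleyPencil.Herglotz

/-! ### Elementary consequences of Toeplitz positivity -/

/-! Toeplitz positivity of a real sequence `c` (symmetric extension understood) is the hypothesis
`hc : ∀ (a : ℕ → ℝ) (M : ℕ), 0 ≤ ∑ m ∈ range M, ∑ n ∈ range M, a m * a n * c (max m n - min m n)` throughout. -/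

/-- A Toeplitz-positive sequence has `0 ≤ c 0` (the `1 × 1` form). [folklore] -/
theorem toeplitzPSD_zero_nonneg {c : ℕ → ℝ}
    (hc : ∀ (a : ℕ → ℝ) (M : ℕ), 0 ≤ ∑ m ∈ range M, ∑ n ∈ range M, a m * a n * c (max m n - min m n)) :
    0 ≤ c 0 := by
  have h := hc (fun _ => 1) 1
  simpa using h

/-- `|c k| ≤ c 0` (the `2 × 2` Toeplitz minors at lags `0, k`). [folklore] -/
theorem toeplitzPSD_abs_le {c : ℕ → ℝ}
    (hc : ∀ (a : ℕ → ℝ) (M : ℕ), 0 ≤ ∑ m ∈ range M, ∑ n ∈ range M, a m * a n * c (max m n - min m n))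
    (k : ℕ) : |c k| ≤ c 0 := by
  rcases Nat.eq_zero_or_pos k with rfl | hk
  · exact (abs_of_nonneg (toeplitzPSD_zero_nonneg hc)).le
  -- coefficients supported on `{0, k}`
  have key : ∀ s : ℝ, s = 1 ∨ s = -1 →
      ∑ m ∈ range (k + 1), ∑ n ∈ range (k + 1),
        (fun i => if i = 0 then (1:ℝ) else if i = k then s else 0) m *
        (fun i => if i = 0 then (1:ℝ) else if i = k then s else 0) n * c (max m n - min m n) =
      2 * c 0 + 2 * s * c k := by
    intro s hs
    have hs2 : s * s = 1 := by rcases hs with rfl | rfl <;> norm_num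
    have hk0 : k ≠ 0 := hk.ne'
    -- evaluate the double sum: only `(0,0), (0,k), (k,0), (k,k)` contribute
    have inner_eval : ∀ m : ℕ, m ∈ range (k + 1) →
        ∑ n ∈ range (k + 1),
          (fun i => if i = 0 then (1:ℝ) else if i = k then s else 0) m *
          (fun i => if i = 0 then (1:ℝ) else if i = k then s else 0) n * c (max m n - min m n) =
        (fun i => if i = 0 then (1:ℝ) else if i = k then s else 0) m *
          (c (max m 0 - min m 0) + s * c (max m k - min m k)) := by
      intro m hm
      have h0 : (0 : ℕ) ∈ range (k + 1) := by simp
      have hkk : k ∈ range (k + 1) := by simp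
      rw [← Finset.add_sum_erase _ _ h0]
      have hk' : k ∈ (range (k + 1)).erase 0 := by simp [hk0]
      rw [← Finset.add_sum_erase _ _ hk']
      have hrest : ∑ n ∈ ((range (k + 1)).erase 0).erase k,
          (fun i => if i = 0 then (1:ℝ) else if i = k then s else 0) m *
          (fun i => if i = 0 then (1:ℝ) else if i = k then s else 0) n * c (max m n - min m n) = 0 := by
        refine Finset.sum_eq_zero fun n hn => ?_
        simp only [mem_erase, mem_range] at hn
        have h1 : n ≠ k := hn.1
        have h2 : n ≠ 0 := hn.2.1
        simp [h1, h2]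
      rw [hrest]
      simp only [if_true, hk0, if_false]
      ring
    rw [Finset.sum_congr rfl inner_eval]
    have h0 : (0 : ℕ) ∈ range (k + 1) := by simp
    rw [← Finset.add_sum_erase _ _ h0]
    have hk' : k ∈ (range (k + 1)).erase 0 := by simp [hk0]
    rw [← Finset.add_sum_erase _ _ hk']
    have hrest : ∑ m ∈ ((range (k + 1)).erase 0).erase k,
        (fun i => if i = 0 then (1:ℝ) else if i = k then s else 0) m *
          (c (max m 0 - min m 0) + s * c (max m k - min m k)) = 0 := by
      refine Finset.sum_eq_zero fun m hm => ?_
      simp only [mem_erase, mem_range] at hm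
      simp [hm.1, hm.2.1]
    rw [hrest]
    simp only [if_true, hk0, if_false, max_self, min_self, Nat.sub_self, Nat.max_eq_left (Nat.zero_le k),
      Nat.min_eq_right (Nat.zero_le k), max_eq_right (Nat.zero_le k), min_eq_left (Nat.zero_le k),
      Nat.sub_zero]
    have : s * (c k) + s * (c 0 + s * c 0) = s * c k + s * c 0 + c 0 := by rw [mul_add, ← mul_assoc, hs2]; ring
    nlinarith [this, hs2]
  have hp := hc (fun i => if i = 0 then (1:ℝ) else if i = k then 1 else 0) (k + 1)
  have hm := hc (fun i => if i = 0 then (1:ℝ) else if i = k then -1 else 0) (k + 1)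
  rw [key 1 (Or.inl rfl)] at hp
  rw [key (-1) (Or.inr rfl)] at hm
  rw [_root_.abs_le]; constructor <;> linarith

/-! ### The Fejér means -/

/-- `cos((max m n - min m n) θ) = cos(mθ) cos(nθ) + sin(mθ) sin(nθ)`. [folklore] -/
theorem cos_absdiff_mul (m n : ℕ) (θ : ℝ) :
    Real.cos (((max m n - min m n : ℕ) : ℝ) * θ) =
      Real.cos (m * θ) * Real.cos (n * θ) + Real.sin (m * θ) * Real.sin (n * θ) := by
  rcases le_total n m with h | h
  · rw [max_eq_left h, min_eq_right h, Nat.cast_sub h, sub_mul, Real.cos_sub]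
  · rw [max_eq_right h, min_eq_left h, Nat.cast_sub h, sub_mul, Real.cos_sub]
    ring

/-- The (unnormalised) Fejér mean `F_M(θ) = Σ_{m,n<M} c_{|m-n|} cos((m-n)θ)`. [folklore] -/
def fejerSum (c : ℕ → ℝ) (M : ℕ) (θ : ℝ) : ℝ :=
  ∑ m ∈ range M, ∑ n ∈ range M, c (max m n - min m n) * Real.cos (((max m n - min m n : ℕ) : ℝ) * θ)

/-- Positivity of the Fejér means: `F_M(θ) = Σ a a c + Σ b b c ≥ 0` with `a_m = cos mθ`, `b_m = sin mθ`. [folklore] -/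
theorem fejerSum_nonneg {c : ℕ → ℝ}
    (hc : ∀ (a : ℕ → ℝ) (M : ℕ), 0 ≤ ∑ m ∈ range M, ∑ n ∈ range M, a m * a n * c (max m n - min m n))
    (M : ℕ) (θ : ℝ) : 0 ≤ fejerSum c M θ := by
  have h1 := hc (fun m => Real.cos (m * θ)) M
  have h2 := hc (fun m => Real.sin (m * θ)) M
  have e : fejerSum c M θ =
      (∑ m ∈ range M, ∑ n ∈ range M, Real.cos (m * θ) * Real.cos (n * θ) * c (max m n - min m n)) +
      (∑ m ∈ range M, ∑ n ∈ range M, Real.sin (m * θ) * Real.sin (n * θ) * c (max m n - min m n)) := by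
    unfold fejerSum
    rw [← Finset.sum_add_distrib]
    refine Finset.sum_congr rfl fun m _ => ?_
    rw [← Finset.sum_add_distrib]
    refine Finset.sum_congr rfl fun n _ => ?_
    rw [cos_absdiff_mul]; ring
  rw [e]; exact add_nonneg h1 h2

/-- Continuity of the Fejér means. [folklore] -/
theorem continuous_fejerSum (c : ℕ → ℝ) (M : ℕ) : Continuous (fejerSum c M) := by
  unfold fejerSum; fun_prop

/-- **Double-sum to single-sum**: `Σ_{m,n<M} F(|m-n|) = M F(0) + 2 Σ_{1≤k<M} (M-k) F(k)`. [folklore] -/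
theorem sum_sum_absdiff {α : Type*} [CommRing α] (F : ℕ → α) (M : ℕ) :
    ∑ m ∈ range M, ∑ n ∈ range M, F (max m n - min m n) =
      (M : α) * F 0 + 2 * ∑ k ∈ Ico 1 M, ((M : α) - k) * F k := by
  induction M with
  | zero => simp
  | succ M ih =>
    rw [Finset.sum_range_succ]
    have hcol : ∀ m ∈ range M, ∑ n ∈ range (M + 1), F (max m n - min m n) =
        ∑ n ∈ range M, F (max m n - min m n) + F (M - m) := by
      intro m hm
      rw [Finset.sum_range_succ]
      have hm' : m ≤ M := (mem_range.1 hm).le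
      rw [max_eq_right hm', min_eq_left hm']
    rw [Finset.sum_congr rfl hcol, Finset.sum_add_distrib, ih]
    -- the new row `m = M`
    have hrow : ∑ n ∈ range (M + 1), F (max M n - min M n) = ∑ n ∈ range M, F (M - n) + F 0 := by
      rw [Finset.sum_range_succ, max_self, min_self, Nat.sub_self]
      congr 1
      refine Finset.sum_congr rfl fun n hn => ?_
      have hn' : n ≤ M := (mem_range.1 hn).le
      rw [max_eq_left hn', min_eq_right hn']
    rw [hrow]
    -- reindex `Σ_{m<M} F(M-m) = Σ_{k∈Ico 1 (M+1)} F k`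
    have hrefl : ∑ m ∈ range M, F (M - m) = ∑ k ∈ Ico 1 (M + 1), F k := by
      rw [Finset.range_eq_Ico, Finset.sum_Ico_reflect _ 0 (Nat.le_succ M)]
      · simp
    rw [hrefl]
    -- split the `Ico 1 (M+1)` sums at `M`
    have hsplit1 : ∑ k ∈ Ico 1 (M + 1), F k = ∑ k ∈ Ico 1 M, F k + (if 1 ≤ M then F M else 0) := by
      by_cases hM : 1 ≤ M
      · rw [Finset.sum_Ico_succ_top hM, if_pos hM]
      · push Not at hM
        interval_cases M; simp
    have hsplit2 : ∑ k ∈ Ico 1 (M + 1), (((M + 1 : ℕ) : α) - k) * F k =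
        ∑ k ∈ Ico 1 M, (((M + 1 : ℕ) : α) - k) * F k + (if 1 ≤ M then (((M + 1 : ℕ) : α) - M) * F M else 0) := by
      by_cases hM : 1 ≤ M
      · rw [Finset.sum_Ico_succ_top hM, if_pos hM]
      · push Not at hM
        interval_cases M; simp
    rw [hsplit1, hsplit2]
    have hdiff : ∑ k ∈ Ico 1 M, (((M + 1 : ℕ) : α) - k) * F k =
        ∑ k ∈ Ico 1 M, ((M : α) - k) * F k + ∑ k ∈ Ico 1 M, F k := by
      rw [← Finset.sum_add_distrib]
      refine Finset.sum_congr rfl fun k _ => ?_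
      push_cast; ring
    rw [hdiff]
    by_cases hM : 1 ≤ M
    · simp only [if_pos hM]; push_cast; ring
    · simp only [if_neg hM]; push_cast; ring

/-- The Fejér mean in cosine-polynomial form:
`F_M(θ) = M c_0 + 2 Σ_{1≤k<M} (M-k) c_k cos(kθ)`. [folklore] -/
theorem fejerSum_eq (c : ℕ → ℝ) (M : ℕ) (θ : ℝ) :
    fejerSum c M θ = (M : ℝ) * c 0 + 2 * ∑ k ∈ Ico 1 M, ((M : ℝ) - k) * (c k * Real.cos (k * θ)) := by
  have h := sum_sum_absdiff (fun k => c k * Real.cos ((k : ℝ) * θ)) M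
  simp only [Nat.cast_zero, zero_mul, Real.cos_zero, mul_one] at h
  exact h

/-! ### Orthogonality of cosines on `[-π, π]` -/

/-! `∫_{-π}^{π} cos(n θ) dθ = 2π · 𝟙{n = 0}` for an integer `n` is the landed
`Literature.Barriers.CriticalPhenomena.Edwards2D.integral_cos_int_mul_eq_ite`. -/

/-- Product-to-sum. [folklore] -/
theorem two_mul_cos_mul_cos (a b : ℝ) : 2 * (Real.cos a * Real.cos b) = Real.cos (a - b) + Real.cos (a + b) := by
  rw [Real.cos_sub, Real.cos_add]; ring

/-- Orthogonality: for naturals `k, j`, `∫_{-π}^{π} cos(kθ) cos(jθ) dθ` is `2π` if `k = j = 0`, `π` if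
`k = j ≥ 1`, and `0` otherwise. [folklore] -/
theorem integral_cos_mul_cos (k j : ℕ) :
    ∫ θ in (-π)..π, Real.cos (k * θ) * Real.cos (j * θ) =
      if k = j then (if k = 0 then 2 * π else π) else 0 := by
  have e : (fun θ : ℝ => Real.cos (k * θ) * Real.cos (j * θ)) =
      fun θ => (1/2 : ℝ) * (Real.cos (((k : ℤ) - j : ℤ) * θ) + Real.cos (((k : ℤ) + j : ℤ) * θ)) := by
    funext θ
    have := two_mul_cos_mul_cos (k * θ) (j * θ)
    push_cast
    rw [show ((k : ℝ) - j) * θ = k * θ - j * θ by ring, show ((k : ℝ) + j) * θ = k * θ + j * θ by ring]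
    linarith
  rw [e, intervalIntegral.integral_const_mul,
    intervalIntegral.integral_add (Continuous.intervalIntegrable (by fun_prop) _ _)
      (Continuous.intervalIntegrable (by fun_prop) _ _),
    Literature.Barriers.CriticalPhenomena.Edwards2D.integral_cos_int_mul_eq_ite,
    Literature.Barriers.CriticalPhenomena.Edwards2D.integral_cos_int_mul_eq_ite]
  by_cases hkj : k = j
  · subst hkj
    by_cases hk : k = 0
    · subst hk
      simp only [Nat.cast_zero, sub_self, add_zero, if_true]
      ring
    · have h2 : ((k : ℤ) + k : ℤ) ≠ 0 := by omega
      simp only [sub_self, if_true, h2, if_false, hk, add_zero]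
      ring
  · have h1 : ((k : ℤ) - j : ℤ) ≠ 0 := by omega
    have h2 : ((k : ℤ) + j : ℤ) ≠ 0 := by
      intro h; have : k = 0 ∧ j = 0 := by omega
      exact hkj (this.1.trans this.2.symm)
    simp [h1, h2, hkj]

/-! ### Moments of the Fejér means -/

/-- `∫_{-π}^{π} cos(kθ) F_M(θ) dθ = 2π (M - k)₊ c_k` (for `k < M`; `0` beyond). [folklore] -/
theorem integral_cos_mul_fejerSum (c : ℕ → ℝ) (M k : ℕ) :
    ∫ θ in (-π)..π, Real.cos (k * θ) * fejerSum c M θ =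
      2 * π * (if k < M then ((M : ℝ) - k) * c k else 0) := by
  simp_rw [fejerSum_eq, mul_add, Finset.mul_sum]
  rw [intervalIntegral.integral_add (Continuous.intervalIntegrable (by fun_prop) _ _)
      (Continuous.intervalIntegrable (by fun_prop) _ _)]
  rw [intervalIntegral.integral_finsetSum (fun i _ => Continuous.intervalIntegrable (by fun_prop) _ _)]
  -- first term: `M c_0 ∫ cos(kθ)`
  have t1 : ∫ θ in (-π)..π, Real.cos (k * θ) * ((M : ℝ) * c 0) = (if k = 0 then 2 * π else 0) * ((M : ℝ) * c 0) := by
    rw [intervalIntegral.integral_mul_const]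
    congr 1
    have := Literature.Barriers.CriticalPhenomena.Edwards2D.integral_cos_int_mul_eq_ite (k : ℤ)
    push_cast at this
    rw [this]
    simp
  -- generic term
  have t2 : ∀ i ∈ Ico 1 M, ∫ θ in (-π)..π, Real.cos (k * θ) * (2 * (((M : ℝ) - i) * (c i * Real.cos (i * θ)))) =
      2 * ((M : ℝ) - i) * c i * (if k = i then π else 0) := by
    intro i hi
    have hi1 : 1 ≤ i := (mem_Ico.1 hi).1
    have e : (fun θ => Real.cos (k * θ) * (2 * (((M : ℝ) - i) * (c i * Real.cos (i * θ))))) =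
        fun θ => (2 * ((M : ℝ) - i) * c i) * (Real.cos (k * θ) * Real.cos (i * θ)) := by
      funext θ; ring
    rw [e, intervalIntegral.integral_const_mul, integral_cos_mul_cos]
    by_cases hki : k = i
    · subst hki
      have : k ≠ 0 := by omega
      simp [this]
    · simp [hki]
  rw [t1, Finset.sum_congr rfl t2]
  by_cases hk : k = 0
  · subst hk
    have hz : ∀ i ∈ Ico 1 M, 2 * ((M : ℝ) - i) * c i * (if (0 : ℕ) = i then π else 0) = 0 := by
      intro i hi
      have : (0 : ℕ) ≠ i := by have := (mem_Ico.1 hi).1; omega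
      simp [this]
    rw [Finset.sum_congr rfl hz, Finset.sum_const_zero, add_zero]
    by_cases hM : 0 < M
    · simp [hM]
    · have : M = 0 := by omega
      subst this; simp
  · simp only [hk, if_false, zero_mul, zero_add]
    by_cases hkM : k < M
    · have hmem : k ∈ Ico 1 M := mem_Ico.2 ⟨Nat.one_le_iff_ne_zero.2 hk, hkM⟩
      rw [← Finset.add_sum_erase _ _ hmem]
      have hz : ∀ i ∈ (Ico 1 M).erase k, 2 * ((M : ℝ) - i) * c i * (if k = i then π else 0) = 0 := by
        intro i hi
        have : k ≠ i := fun h => (mem_erase.1 hi).1 h.symm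
        simp [this]
      rw [Finset.sum_congr rfl hz, Finset.sum_const_zero, add_zero, if_pos rfl, if_pos hkM]
      ring
    · rw [if_neg hkM]
      have hz : ∀ i ∈ Ico 1 M, 2 * ((M : ℝ) - i) * c i * (if k = i then π else 0) = 0 := by
        intro i hi
        have : k ≠ i := by have := (mem_Ico.1 hi).2; omega
        simp [this]
      rw [Finset.sum_congr rfl hz, Finset.sum_const_zero, mul_zero]

/-! ### Registered sub-goal of `stub_stieltjesOfPencil` closed by this file -/

/-- **Sub-goal `stub_stieltjesOfPencil_fejerMoments`** (part 2/5 of `stub_stieltjesOfPencil`, line `cayley-pencil`):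
the cosine moments of the Fejér means, `∫_{-π}^{π} cos(kθ) Σ_{m,n<M} c_{|m-n|} cos((m-n)θ) dθ = 2π (M - k)₊ c_k`
(`integral_cos_mul_fejerSum` with the Fejér sum spelled out). [folklore] -/
theorem stub_stieltjesOfPencil_fejerMoments :
    ∀ (c : ℕ → ℝ) (M k : ℕ), ∫ θ in (-Real.pi)..Real.pi, Real.cos (k * θ) *
        (∑ m ∈ Finset.range M, ∑ n ∈ Finset.range M,
          c (max m n - min m n) * Real.cos (((max m n - min m n : ℕ) : ℝ) * θ)) =
      2 * Real.pi * (if k < M then ((M : ℝ) - k) * c k else 0) := by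
  intro c M k
  exact integral_cos_mul_fejerSum c M k

end Summit.AtomisticToContinuum.FouriersLaw.Theorems.ContactStieltjesMeasure.CayleyPencil.Herglotz

end
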